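import Summits.PneNP.PneNP.Theorems.ChebyshevTracialDesignCrossingPlaneAverage
import Summits.PneNP.PneNP.Theorems.ChebyshevTracialDesignBoundedDimension
import HarnessLib

/-!
# Cell pnp-psdrank, route `ChebyshevTracialDesign`: the two auxiliary error scales of the `M`-averaged bounds are below the crux's scale
# `e^{−a·dq n}` — brick 146b (crux `TracialDecayExp20`, stmt-PneNP-19878)

Brick 146b (prover g29; MEMO-32 §6). The `M`-averaged bounds of bricks 127/128c/144/145/146 carry, next to `e^{−a·dq n}`, the aligned-matching tail
`2^{−⌊n/40⌋}` (the engine's crossing-count tails) and — after the containment reduction of brick 101 — the attenuation factor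
`√P_{dq n − 4}`, `P_k = Π_{i ≤ k/2} (2i+1)/(n−2i)`. Both are eventually below `e^{−a·dq n}` for EVERY `a > 0` (`dq n ≍ n^{1/4}`):
* **`half_pow_le_exp_dq`** (`2^{−⌊n/40⌋} ≤ e^{−a·dq n}` once `dq n ≥ 40a/log 2 + 40`, via `dq n⁴ ≤ n`),
  **`sqrt_attenuation_le_exp_dq`** (`√P_{dq n−4} ≤ e^{−a·dq n}` once `dq n ≥ 6` and `dq n·(1 + e^{8a}) ≤ n`: every factor is `≤ dq n/(n − dq n) ≤ e^{−8a}`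
  and there are `(dq n − 4)/2 + 1 ≥ dq n/4` of them under the square root).
So every such bound can be quoted at the crux's own scale `C·G·n⁶·e^{−a·dq n}` (three terms ↦ `3e^{−a dq n}`). Pure real arithmetic.
WHAT THIS FILE DOES NOT DO: anything combinatorial; anything on `TracialDecayExp20` itself, psd rank of P_PM(K_n), or P vs NP.
[cite: CoppersmithRivlin1992, Thm. (p. 970)] [cite: Rothvoss2017, §2 (PDF p. 6)]
Stature: support/instrument (kernel lane, no defs, axioms standard). Supports stmt-PneNP-19878.
-/

set_option linter.dupNamespace false -- `Summit.PneNP.PneNP.…`: summit = sub-problem (D-0017)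

noncomputable section

namespace Summit.PneNP.PneNP.Theorems.ChebyshevTracialDesignErrorScales

open Finset Literature.Combinatorics.Optimization
open Summit.PneNP.PneNP.Theorems.ChebyshevTracialDesignCrossingPlaneAverage (dq_Tq_facts)
open Summit.PneNP.PneNP.Theorems.ChebyshevTracialDesignBoundedDim (le_dq_of_pow_le)

/-- **The aligned-matching tail is below the crux's scale**: for every `a > 0` there is `n₀` with `(1/2)^{⌊n/40⌋} ≤ e^{−a·dq n}` for `n ≥ n₀`.
[cite: Rothvoss2017, §2 (PDF p. 6)] -/
theorem half_pow_le_exp_dq {a : ℝ} (ha : 0 < a) :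
    ∃ n₀ : ℕ, ∀ n : ℕ, n₀ ≤ n → (1 / 2 : ℝ) ^ (n / 40) ≤ Real.exp (-(a * dq n)) := by
  have hlog : 0 < Real.log 2 := Real.log_pos (by norm_num)
  obtain ⟨D₀, hD₀⟩ : ∃ D₀ : ℕ, 40 * a / Real.log 2 + 40 ≤ D₀ := ⟨⌈40 * a / Real.log 2 + 40⌉₊, Nat.le_ceil _⟩
  refine ⟨max (D₀ ^ 4) 16, fun n hn => ?_⟩
  have hn16 : 16 ≤ n := le_trans (le_max_right _ _) hn
  have hDD₀ : D₀ ≤ dq n := le_dq_of_pow_le (le_trans (le_max_left _ _) hn)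
  obtain ⟨hdq4, -, -, -⟩ := dq_Tq_facts hn16
  -- `⌊n/40⌋·log 2 ≥ a·dq n`
  have hD : (40 * a / Real.log 2 + 40 : ℝ) ≤ dq n := hD₀.trans (by exact_mod_cast hDD₀)
  have hD1 : (1 : ℝ) ≤ dq n := by linarith [div_nonneg (by positivity : (0:ℝ) ≤ 40 * a) hlog.le]
  have hn4 : ((dq n : ℝ)) ^ 4 ≤ n := by exact_mod_cast hdq4
  have hfloor : (n : ℝ) / 40 - 1 ≤ ((n / 40 : ℕ) : ℝ) := by
    have h1 : n < 40 * (n / 40 + 1) := by omega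
    have h2 : (n : ℝ) < 40 * (((n / 40 : ℕ) : ℝ) + 1) := by exact_mod_cast h1
    linarith
  have hkey : a * dq n ≤ ((n / 40 : ℕ) : ℝ) * Real.log 2 := by
    -- `dq n⁴·log 2 ≥ dq n·(40a + 40 log 2)` since `dq n³ ≥ dq n ≥ 40a/log 2 + 40`
    have h3 : (dq n : ℝ) ≤ (dq n : ℝ) ^ 3 := le_self_pow₀ hD1 (by norm_num)
    have h4 : 40 * a + 40 * Real.log 2 ≤ (dq n : ℝ) * Real.log 2 := by
      have := mul_le_mul_of_nonneg_right hD hlog.le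
      rwa [add_mul, div_mul_cancel₀ _ hlog.ne'] at this
    have h5 : (dq n : ℝ) * (40 * a + 40 * Real.log 2) ≤ (dq n : ℝ) ^ 4 * Real.log 2 := by
      calc (dq n : ℝ) * (40 * a + 40 * Real.log 2) ≤ (dq n : ℝ) ^ 3 * ((dq n : ℝ) * Real.log 2) :=
            mul_le_mul h3 h4 (by positivity) (by positivity)
        _ = (dq n : ℝ) ^ 4 * Real.log 2 := by ring
    have h6 : (dq n : ℝ) ^ 4 * Real.log 2 ≤ n * Real.log 2 := mul_le_mul_of_nonneg_right hn4 hlog.le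
    nlinarith [hfloor, h5, h6, hD1, hlog]
  have hhalf : (1 / 2 : ℝ) ^ (n / 40) = Real.exp (-(((n / 40 : ℕ) : ℝ) * Real.log 2)) := by
    rw [← Real.exp_log (by norm_num : (0 : ℝ) < 1 / 2), ← Real.exp_nat_mul, one_div, Real.log_inv]; ring_nf
  rw [hhalf]
  exact Real.exp_le_exp.2 (by linarith)

/-- **The attenuation factor is below the crux's scale**: for every `a > 0` there is `n₀` with
`√(Π_{i < (dq n−4)/2+1} (2i+1)/(n−2i)) ≤ e^{−a·dq n}` for `n ≥ n₀`. [cite: Rothvoss2017, §2 (PDF p. 6)] -/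
theorem sqrt_attenuation_le_exp_dq {a : ℝ} (ha : 0 < a) :
    ∃ n₀ : ℕ, ∀ n : ℕ, n₀ ≤ n →
      Real.sqrt (∏ i ∈ range ((dq n - 4) / 2 + 1), ((2 * i + 1 : ℝ) / ((n : ℝ) - 2 * i))) ≤ Real.exp (-(a * dq n)) := by
  obtain ⟨D₀, hD₀⟩ : ∃ D₀ : ℕ, Real.exp (8 * a) + 1 ≤ D₀ := ⟨⌈Real.exp (8 * a) + 1⌉₊, Nat.le_ceil _⟩
  refine ⟨max (max (D₀ ^ 4) (6 ^ 4)) 16, fun n hn => ?_⟩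
  have hn16 : 16 ≤ n := le_trans (le_max_right _ _) hn
  have hDD₀ : D₀ ≤ dq n := le_dq_of_pow_le (le_trans (le_trans (le_max_left _ _) (le_max_left _ _)) hn)
  have hD6 : 6 ≤ dq n := le_dq_of_pow_le (le_trans (le_trans (le_max_right _ _) (le_max_left _ _)) hn)
  obtain ⟨hdq4, -, -, -⟩ := dq_Tq_facts hn16
  have hDr : Real.exp (8 * a) + 1 ≤ dq n := hD₀.trans (by exact_mod_cast hDD₀)
  have hD1 : (1 : ℝ) ≤ dq n := by linarith [Real.exp_pos (8 * a)]
  have hn4 : ((dq n : ℝ)) ^ 4 ≤ n := by exact_mod_cast hdq4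
  -- `dq n·(1 + e^{8a}) ≤ dq n⁴ ≤ n`, so `dq n/(n − dq n) ≤ e^{−8a}`
  have hgap : (dq n : ℝ) * Real.exp (8 * a) ≤ (n : ℝ) - dq n := by
    have h3 : (dq n : ℝ) ≤ (dq n : ℝ) ^ 3 := le_self_pow₀ hD1 (by norm_num)
    have : (dq n : ℝ) * (Real.exp (8 * a) + 1) ≤ (dq n : ℝ) ^ 4 := by
      calc (dq n : ℝ) * (Real.exp (8 * a) + 1) ≤ (dq n : ℝ) ^ 3 * dq n := mul_le_mul h3 hDr (by positivity) (by positivity)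
        _ = (dq n : ℝ) ^ 4 := by ring
    linarith
  have hnD : 0 < (n : ℝ) - dq n := lt_of_lt_of_le (by positivity) hgap
  -- each factor
  have hfac : ∀ i ∈ range ((dq n - 4) / 2 + 1), ((2 * i + 1 : ℝ) / ((n : ℝ) - 2 * i)) ≤ Real.exp (-(8 * a)) := by
    intro i hi
    have hi' : 2 * i + 1 ≤ dq n := by have := mem_range.1 hi; omega
    have hir : (2 * (i : ℝ) + 1) ≤ dq n := by exact_mod_cast hi'
    have hden : (n : ℝ) - dq n ≤ (n : ℝ) - 2 * i := by linarith
    calc ((2 * i + 1 : ℝ) / ((n : ℝ) - 2 * i)) ≤ (dq n : ℝ) / ((n : ℝ) - dq n) :=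
          div_le_div₀ (by positivity) hir hnD hden
      _ ≤ Real.exp (-(8 * a)) := by
          rw [div_le_iff₀ hnD]
          have hE : 0 < Real.exp (-(8 * a)) := Real.exp_pos _
          have h1 := mul_le_mul_of_nonneg_left hgap hE.le
          have h2 : Real.exp (-(8 * a)) * ((dq n : ℝ) * Real.exp (8 * a)) = dq n := by
            rw [mul_comm, mul_assoc, ← Real.exp_add]; simp
          linarith
  have hfac0 : ∀ i ∈ range ((dq n - 4) / 2 + 1), (0 : ℝ) ≤ ((2 * i + 1 : ℝ) / ((n : ℝ) - 2 * i)) := by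
    intro i hi
    have hi' : 2 * i + 1 ≤ dq n := by have := mem_range.1 hi; omega
    have hir : (2 * (i : ℝ) + 1) ≤ dq n := by exact_mod_cast hi'
    have : (0 : ℝ) < (n : ℝ) - 2 * i := by linarith
    positivity
  have hprod : ∏ i ∈ range ((dq n - 4) / 2 + 1), ((2 * i + 1 : ℝ) / ((n : ℝ) - 2 * i)) ≤
      Real.exp (-(8 * a)) ^ ((dq n - 4) / 2 + 1) := by
    refine (prod_le_prod hfac0 hfac).trans (le_of_eq ?_)
    rw [prod_const, card_range]
  -- exponent bookkeeping: `4·((dq n − 4)/2 + 1) ≥ dq n`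
  have hcount : dq n ≤ 4 * ((dq n - 4) / 2 + 1) := by omega
  have hexp : Real.exp (-(8 * a)) ^ ((dq n - 4) / 2 + 1) ≤ Real.exp (-(a * dq n)) ^ 2 := by
    rw [← Real.exp_nat_mul, ← Real.exp_nat_mul]
    refine Real.exp_le_exp.2 ?_
    have : ((dq n : ℕ) : ℝ) ≤ 4 * ((((dq n - 4) / 2 + 1 : ℕ)) : ℝ) := by exact_mod_cast hcount
    push_cast at this ⊢
    nlinarith [this, ha.le]
  calc Real.sqrt (∏ i ∈ range ((dq n - 4) / 2 + 1), ((2 * i + 1 : ℝ) / ((n : ℝ) - 2 * i)))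
      ≤ Real.sqrt (Real.exp (-(a * dq n)) ^ 2) := Real.sqrt_le_sqrt (hprod.trans hexp)
    _ = Real.exp (-(a * dq n)) := Real.sqrt_sq (Real.exp_pos _).le

end Summit.PneNP.PneNP.Theorems.ChebyshevTracialDesignErrorScales

end
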